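import Literature.NumberTheory.LFunctions.TaoLogElliottCircleMethod
import Mathlib.Data.ZMod.QuotientRing
import Mathlib.NumberTheory.Bertrand
import Mathlib.Analysis.SpecialFunctions.Trigonometric.Series
import Mathlib.Analysis.Convex.SpecificFunctions.Basic
import HarnessLib

/-!
# Tao's log-averaged Elliott theorem: Lemma 3.5 (Hoeffding's inequality), proved

Part of the proof DAG below the named fact `Literature.NumberTheory.LFunctions.Tao2016_theorem23` (Tao, Forum Math. Pi 4
(2016) e8, Theorem 2.3).  The printed proof (§3) decouples the random variables `X_H` and `Y_H`
through Lemma 3.3 (weak uniform distribution, entropy) and **Lemma 3.5 (Hoeffding inequality)**: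
for every value `x` of `X_H`, the bilinear form `F(x, y)` along the random graph determined by
`y ∈ ℤ/P_Hℤ` concentrates around its mean, outside a set `E_x` of measure
`≤ exp(-ε⁷ H / log H)`.  This file PROVES Lemma 3.5 for general phases `c_p` (the paper:
`c_p = ḡ₁(p)ḡ₂(p)`), with explicit constants, following the printed proof: `F = ∑_p F_p`,
`F_p(x, y)` depends only on `y mod p`, the `y mod p` are independent and uniform by the Chinese
remainder theorem (`ZMod.prodEquivPi`), `|F_p| = O(H/p)`-bounded, and Hoeffding's inequality.

## Main statements (namespace `Literature.Tao2016`)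

* `hoeffding_lemma_sum` — Hoeffding's lemma, finite uniform form:
  `∑_{a∈A} exp(λ f(a)) ≤ #A exp(λ²c²/2)` for `f` of mean zero with `|f| ≤ c` on `A`
  (chord of `exp` on `[-c, c]`, `cosh x ≤ exp(x²/2)`);
  `hoeffding_count_pi` / `hoeffding_count_pi_complex` — Hoeffding's inequality in counting form on
  a finite product space `Π_i κ_i` (one-sided real; two-sided complex with the factor `4` and
  `exp(-t²/(8 ∑ c_i²))`).
* `jRange`, `Floc` (`F_p` as a function of `y mod p`), `FlocMean` (its mean,
  `∑_p FlocMean = bilinC`: `sum_FlocMean_eq_bilinC`), `Fbil` (`F(x, ·)` on `ℤ/Pℤ`);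
  `sum_Floc_eq` — the mean of `F_p` (`p ∤ a`: one residue `y mod p` per `j`);
  `norm_Floc_le`, `norm_FlocMean_le` — `|F_p| ≤ |c_p| B₁B₂ (H/p + 1)`.
* `lemma35_count` — **Lemma 3.5, explicit counting form**: for a nonempty finite set `𝒫` of
  primes not dividing `a`, `P = ∏ p`, `|c_p| ≤ 1`, `|x_{i,j}| ≤ B_i` on `[1, H]`, `t ≥ 0`:
  `#{y ∈ ℤ/Pℤ : |F(x,y) - bilinC| ≥ t} ≤ 4 exp(-t²/(8 ∑_p (2B₁B₂(H/p+1))²)) · P`.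
* `lemma35` — **Lemma 3.5 as printed**: `|E_x| ≤ exp(-ε⁷ H/log H) · P_H` for `𝒫 = 𝒫_H`,
  `t = ε²H/log H`, entries of modulus `≤ 2`, under `0 < ε ≤ 1/27648`, `ε⁴H ≥ 4`,
  `ε⁷H/log H ≥ 2`, `1 ≤ a < ε²H/2` (explicit stand-ins for the hierarchy `a ≪ 1/ε ≪ H₋ ≤ H`);
  `primesP_nonempty` (Bertrand).

## References
* T. Tao, *The logarithmically averaged Chowla and Elliott conjectures for two-point
  correlations*, Forum Math. Pi 4 (2016), e8; arXiv:1509.05422, §3, Lemma 3.5 and its proof;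
  §2, definition of `F`, `X_H`, `Y_H`, `P_H` before Remark 2.7.
* W. Hoeffding, *Probability inequalities for sums of bounded random variables*,
  J. Amer. Statist. Assoc. 58 (1963), 13–30 (Theorem 2).

## Design choices / deviations
* `y ∈ ℤ/P_Hℤ` is `y : ZMod P` with `P = ∏_{p∈𝒫} p` supplied through `hP` (and `[NeZero P]`);
  `F_p` reads `y` through `ZMod.cast : ZMod P → ZMod p`.  The constraint `1_{ay+j ≡ pb (ap)}` of
  the paper is split as `p ∣ ay + j` (inside `Floc`) and `j ≡ pb (a)` (inside `jRange`), valid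
  as `p ∤ a`.
* The mean `(1/P_H)∑_{y} F(x, y)` is entered in its closed form
  `∑_p (c_p/p) ∑_j 1_{j≡pb (a)} x_{1,j}x_{2,j+ph} = bilinC` (the display following the proof of
  Lemma 3.5 in the paper), which is what `sum_Floc_eq` computes prime by prime.
* Hoeffding is proved from scratch in counting form (no measure theory), complex-valued via real
  and imaginary parts; constants are not optimised (`4 exp(-t²/(8∑c²))`).
-/

open Finset Real Complex
open scoped ComplexConjugate

namespace Literature.NumberTheory.LFunctions

namespace Tao2016


/-! ### Hoeffding's lemma and inequality on finite product spaces (counting form) -/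

/-- The chord bound for the exponential on `[-c, c]`:
`exp(λu) ≤ ((c - u) exp(-λc) + (c + u) exp(λc)) / (2c)` for `|u| ≤ c`, `c > 0`. [folklore] -/
theorem exp_mul_le_chord {c u : ℝ} (hc : 0 < c) (hu : |u| ≤ c) (l : ℝ) :
    Real.exp (l * u) ≤ ((c - u) * Real.exp (-(l * c)) + (c + u) * Real.exp (l * c)) / (2 * c) := by
  have h1 : -c ≤ u := by linarith [abs_le.1 hu |>.1]
  have h2 : u ≤ c := (abs_le.1 hu).2
  set θ : ℝ := (c - u) / (2 * c) with hθ
  have hθ0 : 0 ≤ θ := by positivity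
  have hθ1 : θ ≤ 1 := by rw [hθ, div_le_one (by positivity)]; linarith
  have hconv := (convexOn_exp).2 (Set.mem_univ (-(l * c))) (Set.mem_univ (l * c)) hθ0
    (by linarith : 0 ≤ 1 - θ) (by ring : θ + (1 - θ) = 1)
  simp only [smul_eq_mul] at hconv
  have harg : θ * -(l * c) + (1 - θ) * (l * c) = l * u := by
    rw [hθ]; field_simp; ring
  rw [harg] at hconv
  refine hconv.trans (le_of_eq ?_)
  rw [hθ]; field_simp; ring

/-- **Hoeffding's lemma**, finite uniform form: if `f` has mean zero on the finite set `A` and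
`|f| ≤ c` on `A`, then `∑_{a ∈ A} exp(λ f(a)) ≤ #A · exp(λ² c² / 2)`. [folklore] -/
theorem hoeffding_lemma_sum {α : Type*} (A : Finset α) (f : α → ℝ) {c : ℝ}
    (hf0 : ∑ a ∈ A, f a = 0) (hfc : ∀ a ∈ A, |f a| ≤ c) (l : ℝ) :
    ∑ a ∈ A, Real.exp (l * f a) ≤ A.card * Real.exp (l ^ 2 * c ^ 2 / 2) := by
  rcases A.eq_empty_or_nonempty with rfl | hA
  · simp
  obtain ⟨a₀, ha₀⟩ := hA
  have hc0 : 0 ≤ c := (abs_nonneg _).trans (hfc a₀ ha₀)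
  rcases hc0.eq_or_lt with rfl | hc
  · -- `c = 0`: `f = 0` on `A`
    have hf : ∀ a ∈ A, f a = 0 := fun a ha => abs_nonpos_iff.1 (hfc a ha)
    calc ∑ a ∈ A, Real.exp (l * f a) = ∑ a ∈ A, (1 : ℝ) :=
          sum_congr rfl fun a ha => by rw [hf a ha, mul_zero, Real.exp_zero]
      _ ≤ A.card * Real.exp (l ^ 2 * 0 ^ 2 / 2) := by simp
  calc ∑ a ∈ A, Real.exp (l * f a)
      ≤ ∑ a ∈ A, ((c - f a) * Real.exp (-(l * c)) + (c + f a) * Real.exp (l * c)) / (2 * c) :=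
        sum_le_sum fun a ha => exp_mul_le_chord hc (hfc a ha) l
    _ = A.card * ((Real.exp (-(l * c)) + Real.exp (l * c)) / 2) +
          (∑ a ∈ A, f a) * ((Real.exp (l * c) - Real.exp (-(l * c))) / (2 * c)) := by
        rw [← sum_div, sum_add_distrib, ← sum_mul, ← sum_mul, sum_sub_distrib, sum_add_distrib,
          sum_const, nsmul_eq_mul]
        field_simp
        ring
    _ = A.card * Real.cosh (l * c) := by rw [hf0, zero_mul, add_zero, Real.cosh_eq]; ring_nf
    _ ≤ A.card * Real.exp (l ^ 2 * c ^ 2 / 2) := by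
        gcongr
        calc Real.cosh (l * c) ≤ Real.exp ((l * c) ^ 2 / 2) := Real.cosh_le_exp_half_sq _
          _ = Real.exp (l ^ 2 * c ^ 2 / 2) := by ring_nf

/-- **Hoeffding's inequality**, counting form on a finite product space (one-sided): for
mean-zero `f_i : κ_i → ℝ` with `|f_i| ≤ c_i`, and `t ≥ 0`,
`#{y : ∑_i f_i(y_i) ≥ t} ≤ exp(-t² / (2 ∑_i c_i²)) · ∏_i #κ_i`. [folklore] -/
theorem hoeffding_count_pi {ι : Type*} [Fintype ι] [DecidableEq ι] {κ : ι → Type*}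
    [∀ i, Fintype (κ i)] [∀ i, DecidableEq (κ i)]
    (f : ∀ i, κ i → ℝ) (c : ι → ℝ) (hf0 : ∀ i, ∑ a, f i a = 0)
    (hfc : ∀ i a, |f i a| ≤ c i) {t : ℝ} (ht : 0 ≤ t) (hS : 0 < ∑ i, c i ^ 2) :
    ((Finset.univ.filter fun y : (∀ i, κ i) => t ≤ ∑ i, f i (y i)).card : ℝ) ≤
      Real.exp (-(t ^ 2 / (2 * ∑ i, c i ^ 2))) * ∏ i, (Fintype.card (κ i) : ℝ) := by
  set S : ℝ := ∑ i, c i ^ 2 with hSdef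
  set l : ℝ := t / S with hl
  have hl0 : 0 ≤ l := by positivity
  set E := Finset.univ.filter fun y : (∀ i, κ i) => t ≤ ∑ i, f i (y i) with hE
  -- `#E · exp(λ t) ≤ ∑_y exp(λ ∑ f) = ∏_i ∑_a exp(λ f_i a) ≤ (∏ #κ_i) exp(λ² S / 2)`
  have h1 : (E.card : ℝ) * Real.exp (l * t) ≤
      ∑ y : (∀ i, κ i), Real.exp (l * ∑ i, f i (y i)) := by
    rw [← nsmul_eq_mul, ← sum_const]
    refine (sum_le_sum fun y hy => ?_).trans
      (sum_le_sum_of_subset_of_nonneg (filter_subset _ _) fun y _ _ => (Real.exp_pos _).le)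
    rw [hE, mem_filter] at hy
    exact Real.exp_le_exp.2 (mul_le_mul_of_nonneg_left hy.2 hl0)
  have h2 : ∑ y : (∀ i, κ i), Real.exp (l * ∑ i, f i (y i)) =
      ∏ i, ∑ a : κ i, Real.exp (l * f i a) := by
    simp_rw [mul_sum, Real.exp_sum]
    exact (prod_univ_sum (fun _ => Finset.univ) fun i a => Real.exp (l * f i a)).symm
  have h3 : ∏ i, ∑ a : κ i, Real.exp (l * f i a) ≤
      ∏ i, ((Fintype.card (κ i) : ℝ) * Real.exp (l ^ 2 * c i ^ 2 / 2)) := by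
    refine prod_le_prod (fun i _ => sum_nonneg fun a _ => (Real.exp_pos _).le) fun i _ => ?_
    have := hoeffding_lemma_sum (Finset.univ : Finset (κ i)) (f i) (hf0 i)
      (fun a _ => hfc i a) l
    simpa using this
  have h4 : ∏ i, ((Fintype.card (κ i) : ℝ) * Real.exp (l ^ 2 * c i ^ 2 / 2)) =
      (∏ i, (Fintype.card (κ i) : ℝ)) * Real.exp (l ^ 2 * S / 2) := by
    rw [prod_mul_distrib, ← Real.exp_sum, hSdef, mul_sum, sum_div]
  have h5 : (E.card : ℝ) * Real.exp (l * t) ≤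
      (∏ i, (Fintype.card (κ i) : ℝ)) * Real.exp (l ^ 2 * S / 2) := by
    calc _ ≤ _ := h1
      _ = _ := h2
      _ ≤ _ := h3
      _ = _ := h4
  -- divide by `exp(λ t)` and simplify the exponent
  have h6 : (E.card : ℝ) ≤ (∏ i, (Fintype.card (κ i) : ℝ)) * Real.exp (l ^ 2 * S / 2 - l * t) := by
    rw [Real.exp_sub, mul_div_assoc']
    rw [le_div_iff₀ (Real.exp_pos _)]
    exact h5
  have h7 : l ^ 2 * S / 2 - l * t = -(t ^ 2 / (2 * S)) := by
    rw [hl]; field_simp; ring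
  rw [h7] at h6
  linarith [h6]

/-- Monotonicity of the counting bound in the event. [folklore] -/
theorem card_filter_le_of_imp {α : Type*} (s : Finset α) {P Q : α → Prop} [DecidablePred P]
    [DecidablePred Q] (h : ∀ a ∈ s, P a → Q a) : (s.filter P).card ≤ (s.filter Q).card :=
  card_le_card fun a ha => by
    rw [mem_filter] at ha ⊢; exact ⟨ha.1, h a ha.1 ha.2⟩

/-- **Hoeffding's inequality**, counting form on a finite product space, complex two-sided
version: for mean-zero `g_i : κ_i → ℂ` with `|g_i| ≤ c_i` and `t ≥ 0`,
`#{y : |∑_i g_i(y_i)| ≥ t} ≤ 4 exp(-t² / (8 ∑_i c_i²)) · ∏_i #κ_i`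
(real and imaginary parts, each side, via `hoeffding_count_pi` at level `t/2`). [folklore] -/
theorem hoeffding_count_pi_complex {ι : Type*} [Fintype ι] [DecidableEq ι] {κ : ι → Type*}
    [∀ i, Fintype (κ i)] [∀ i, DecidableEq (κ i)]
    (g : ∀ i, κ i → ℂ) (c : ι → ℝ) (hg0 : ∀ i, ∑ a, g i a = 0)
    (hgc : ∀ i a, ‖g i a‖ ≤ c i) {t : ℝ} (ht : 0 ≤ t) (hS : 0 < ∑ i, c i ^ 2) :
    ((Finset.univ.filter fun y : (∀ i, κ i) => t ≤ ‖∑ i, g i (y i)‖).card : ℝ) ≤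
      4 * Real.exp (-(t ^ 2 / (8 * ∑ i, c i ^ 2))) * ∏ i, (Fintype.card (κ i) : ℝ) := by
  set B : ℝ := Real.exp (-((t / 2) ^ 2 / (2 * ∑ i, c i ^ 2))) * ∏ i, (Fintype.card (κ i) : ℝ)
    with hB
  have hexp : Real.exp (-(t ^ 2 / (8 * ∑ i, c i ^ 2))) =
      Real.exp (-((t / 2) ^ 2 / (2 * ∑ i, c i ^ 2))) := by
    congr 1; ring
  rw [hexp, show 4 * Real.exp (-((t / 2) ^ 2 / (2 * ∑ i, c i ^ 2))) *
      ∏ i, (Fintype.card (κ i) : ℝ) = B + B + B + B by rw [hB]; ring]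
  have ht2 : 0 ≤ t / 2 := by linarith
  -- the four real one-sided bounds
  have hre : ∀ (s : ℝ), (s = 1 ∨ s = -1) →
      ((Finset.univ.filter fun y : (∀ i, κ i) => t / 2 ≤ ∑ i, s * (g i (y i)).re).card : ℝ)
        ≤ B := by
    intro s hs
    have hs1 : |s| = 1 := by rcases hs with rfl | rfl <;> simp
    refine hoeffding_count_pi (fun i a => s * (g i a).re) c (fun i => ?_) (fun i a => ?_) ht2 hS
    · rw [← mul_sum, ← Complex.re_sum, hg0 i]; simp
    · rw [abs_mul, hs1, one_mul]; exact (Complex.abs_re_le_norm _).trans (hgc i a)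
  have him : ∀ (s : ℝ), (s = 1 ∨ s = -1) →
      ((Finset.univ.filter fun y : (∀ i, κ i) => t / 2 ≤ ∑ i, s * (g i (y i)).im).card : ℝ)
        ≤ B := by
    intro s hs
    have hs1 : |s| = 1 := by rcases hs with rfl | rfl <;> simp
    refine hoeffding_count_pi (fun i a => s * (g i a).im) c (fun i => ?_) (fun i a => ?_) ht2 hS
    · rw [← mul_sum, ← Complex.im_sum, hg0 i]; simp
    · rw [abs_mul, hs1, one_mul]; exact (Complex.abs_im_le_norm _).trans (hgc i a)
  -- union bound
  have hsub : (Finset.univ.filter fun y : (∀ i, κ i) => t ≤ ‖∑ i, g i (y i)‖) ⊆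
      (Finset.univ.filter fun y : (∀ i, κ i) => t / 2 ≤ ∑ i, 1 * (g i (y i)).re) ∪
      (Finset.univ.filter fun y : (∀ i, κ i) => t / 2 ≤ ∑ i, (-1) * (g i (y i)).re) ∪
      (Finset.univ.filter fun y : (∀ i, κ i) => t / 2 ≤ ∑ i, 1 * (g i (y i)).im) ∪
      (Finset.univ.filter fun y : (∀ i, κ i) => t / 2 ≤ ∑ i, (-1) * (g i (y i)).im) := by
    intro y hy
    rw [mem_filter] at hy
    simp only [mem_union, mem_filter, mem_univ, true_and, one_mul, neg_one_mul, sum_neg_distrib]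
    rw [← Complex.re_sum, ← Complex.im_sum]
    have h1 := Complex.norm_le_abs_re_add_abs_im (∑ i, g i (y i))
    have h2 := hy.2
    by_contra hcon
    simp only [not_or, not_le] at hcon
    obtain ⟨⟨⟨h3, h4⟩, h5⟩, h6⟩ := hcon
    have h7 : |(∑ i, g i (y i)).re| < t / 2 := abs_lt.2 ⟨by linarith, h3⟩
    have h8 : |(∑ i, g i (y i)).im| < t / 2 := abs_lt.2 ⟨by linarith, h5⟩
    linarith
  calc ((Finset.univ.filter fun y : (∀ i, κ i) => t ≤ ‖∑ i, g i (y i)‖).card : ℝ)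
      ≤ ((Finset.univ.filter fun y : (∀ i, κ i) => t / 2 ≤ ∑ i, 1 * (g i (y i)).re) ∪
          (Finset.univ.filter fun y : (∀ i, κ i) => t / 2 ≤ ∑ i, (-1) * (g i (y i)).re) ∪
          (Finset.univ.filter fun y : (∀ i, κ i) => t / 2 ≤ ∑ i, 1 * (g i (y i)).im) ∪
          (Finset.univ.filter fun y : (∀ i, κ i) => t / 2 ≤ ∑ i, (-1) * (g i (y i)).im)).card := by
        exact_mod_cast card_le_card hsub
    _ ≤ B + B + B + B := by
        set S₁ := Finset.univ.filter fun y : (∀ i, κ i) => t / 2 ≤ ∑ i, 1 * (g i (y i)).re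
        set S₂ := Finset.univ.filter fun y : (∀ i, κ i) => t / 2 ≤ ∑ i, (-1) * (g i (y i)).re
        set S₃ := Finset.univ.filter fun y : (∀ i, κ i) => t / 2 ≤ ∑ i, 1 * (g i (y i)).im
        set S₄ := Finset.univ.filter fun y : (∀ i, κ i) => t / 2 ≤ ∑ i, (-1) * (g i (y i)).im
        have hc : (S₁ ∪ S₂ ∪ S₃ ∪ S₄).card ≤ S₁.card + S₂.card + S₃.card + S₄.card := by
          have h1 := card_union_le (S₁ ∪ S₂ ∪ S₃) S₄
          have h2 := card_union_le (S₁ ∪ S₂) S₃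
          have h3 := card_union_le S₁ S₂
          omega
        have hc' : ((S₁ ∪ S₂ ∪ S₃ ∪ S₄).card : ℝ) ≤
            (S₁.card : ℝ) + S₂.card + S₃.card + S₄.card := by exact_mod_cast hc
        linarith [hre 1 (Or.inl rfl), hre (-1) (Or.inr rfl), him 1 (Or.inl rfl),
          him (-1) (Or.inr rfl)]

/-! ### Tao's bilinear form `F(x, y)` along the random graph (Tao 2016, §2–3) -/

section TaoF

variable (a H : ℕ) (b h : ℤ) (c : ℕ → ℂ) (x₁ x₂ : ℤ → ℂ)

/-- The `j`-range of `F_p`: `{j ∈ [1, H] : j + ph ∈ [1, H], j ≡ pb (a)}` — the inner range of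
`Literature.NumberTheory.LFunctions.Tao2016.bilinC` (Tao 2016, definition of `F` before Remark 2.7, and Lemma 3.6).
[cite: TaoFMP2016, §2 (definition of F before Remark 2.7)] -/
noncomputable def jRange (p : ℕ) : Finset ℤ :=
  (Icc (1 : ℤ) H).filter fun j => j + p * h ∈ Icc (1 : ℤ) H ∧ (a : ℤ) ∣ j - p * b

/-- `F_p(x, y)` as a function of `z = y mod p` (Tao 2016, proof of Lemma 3.5, definition of
`F_p`): `F_p(x, y) = c_p ∑_{j : j, j+ph ∈ [1,H]} 1_{ay + j ≡ pb (ap)} x_{1,j} x_{2,j+ph}`; for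
`p ∤ a` the constraint `ay + j ≡ pb (ap)` splits as `p ∣ ay + j` and `j ≡ pb (a)`.
[cite: TaoFMP2016, proof of Lemma 3.5 (definition of F_p)] -/
noncomputable def Floc (p : ℕ) (z : ZMod p) : ℂ :=
  c p * ∑ j ∈ jRange a H b h p,
    if (a : ZMod p) * z + (j : ZMod p) = 0 then x₁ j * x₂ (j + p * h) else 0

/-- The mean of `F_p(x, ·)` over `ℤ/pℤ`: `(c_p / p) ∑_{j : j, j+ph ∈ [1,H], j ≡ pb (a)} x_{1,j} x_{2,j+ph}`
(Tao 2016, proof of Theorem 2.3, the display computing `(1/P_H) ∑_{y} F_p(x, y)` after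
Lemma 3.5); summed over `p` this is `Literature.NumberTheory.LFunctions.Tao2016.bilinC` (`sum_FlocMean_eq_bilinC`).
[cite: TaoFMP2016, §3 (display after the proof of Lemma 3.5)] -/
noncomputable def FlocMean (p : ℕ) : ℂ :=
  c p / p * ∑ j ∈ jRange a H b h p, x₁ j * x₂ (j + p * h)

/-- `F(x, y) = ∑_{p ∈ 𝒫_H} F_p(x, y)` for `y ∈ ℤ/Pℤ` (`P = P_H = ∏_{p ∈ 𝒫_H} p`), each `F_p` read
through `y mod p` (Tao 2016, definition of `F` before Remark 2.7 and proof of Lemma 3.5).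
[cite: TaoFMP2016, §2 (definition of F before Remark 2.7)] -/
noncomputable def Fbil (Pr : Finset ℕ) {P : ℕ} (y : ZMod P) : ℂ :=
  ∑ p ∈ Pr, Floc a H b h c x₁ x₂ p (ZMod.cast y : ZMod p)

/-- `∑_{p ∈ 𝒫} (mean of F_p) = bilinC`, the left side of Lemma 3.6. [folklore] -/
theorem sum_FlocMean_eq_bilinC (Pr : Finset ℕ) :
    ∑ p ∈ Pr, FlocMean a H b h c x₁ x₂ p = bilinC H a b h Pr c x₁ x₂ := rfl

variable {a H b h c x₁ x₂}

/-- `#{j ∈ [1, H] : j ≡ r (p)} ≤ H/p + 1` (integer interval). [folklore] -/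
theorem card_filter_intCast_eq_le (H : ℕ) {p : ℕ} (hp : 0 < p) (r : ZMod p) :
    ((Icc (1 : ℤ) H).filter fun j : ℤ => (j : ZMod p) = r).card ≤ H / p + 1 := by
  have hp' : (0 : ℤ) < p := by exact_mod_cast hp
  have hmaps : Set.MapsTo (fun j : ℤ => (j / p).toNat)
      (((Icc (1 : ℤ) H).filter fun j : ℤ => (j : ZMod p) = r) : Set ℤ)
      (range (H / p + 1) : Finset ℕ) := by
    intro j hj
    simp only [coe_filter, mem_Icc, Set.mem_setOf_eq] at hj
    simp only [coe_range, Set.mem_Iio]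
    have h1 : j / p ≤ (H : ℤ) / p := Int.ediv_le_ediv hp' hj.1.2
    have h2 : ((H : ℤ) / p) = ((H / p : ℕ) : ℤ) := (Int.natCast_div H p).symm
    rw [h2] at h1
    exact Nat.lt_succ_of_le (Int.toNat_le.2 h1)
  have hinj : Set.InjOn (fun j : ℤ => (j / p).toNat)
      (((Icc (1 : ℤ) H).filter fun j : ℤ => (j : ZMod p) = r) : Set ℤ) := by
    intro j₁ hj₁ j₂ hj₂ heq
    simp only [coe_filter, mem_Icc, Set.mem_setOf_eq] at hj₁ hj₂
    have h1 : (j₁ : ZMod p) = (j₂ : ZMod p) := by rw [hj₁.2, hj₂.2]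
    have h2 : j₁ % p = j₂ % p := (ZMod.intCast_eq_intCast_iff' j₁ j₂ p).1 h1
    simp only at heq
    have h3 : 0 ≤ j₁ / p := Int.ediv_nonneg (by omega) hp'.le
    have h4 : 0 ≤ j₂ / p := Int.ediv_nonneg (by omega) hp'.le
    have h5 : j₁ / p = j₂ / p := by omega
    rw [← Int.mul_ediv_add_emod j₁ p, ← Int.mul_ediv_add_emod j₂ p, h5, h2]
  have := card_le_card_of_injOn _ hmaps hinj
  simpa using this

/-- `|F_p(x, z)| ≤ |c_p| B₁ B₂ (H/p + 1)`. [folklore] -/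
theorem norm_Floc_le {p : ℕ} (hp : 0 < p) {B₁ B₂ : ℝ} (hB₁ : 0 ≤ B₁) (hB₂ : 0 ≤ B₂)
    (hx₁ : ∀ j ∈ Icc (1 : ℤ) H, ‖x₁ j‖ ≤ B₁) (hx₂ : ∀ j ∈ Icc (1 : ℤ) H, ‖x₂ j‖ ≤ B₂)
    (z : ZMod p) :
    ‖Floc a H b h c x₁ x₂ p z‖ ≤ ‖c p‖ * (B₁ * B₂ * ((H : ℝ) / p + 1)) := by
  unfold Floc
  rw [norm_mul]
  gcongr
  calc ‖∑ j ∈ jRange a H b h p, (if (a : ZMod p) * z + (j : ZMod p) = 0 then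
          x₁ j * x₂ (j + p * h) else 0)‖
      ≤ ∑ j ∈ jRange a H b h p, ‖(if (a : ZMod p) * z + (j : ZMod p) = 0 then
          x₁ j * x₂ (j + p * h) else 0)‖ := norm_sum_le _ _
    _ ≤ ∑ j ∈ Icc (1 : ℤ) H, (if (j : ZMod p) = -((a : ZMod p) * z) then B₁ * B₂ else 0) := by
        refine sum_le_sum_of_subset_of_nonneg (filter_subset _ _) (fun j _ _ => by positivity)
          |>.trans' (sum_le_sum fun j hj => ?_)
        unfold jRange at hj
        simp only [mem_filter] at hj
        have hiff : (a : ZMod p) * z + (j : ZMod p) = 0 ↔ (j : ZMod p) = -((a : ZMod p) * z) := by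
          rw [add_comm, add_eq_zero_iff_eq_neg]
        by_cases hcond : (a : ZMod p) * z + (j : ZMod p) = 0
        · rw [if_pos hcond, if_pos (hiff.1 hcond), norm_mul]
          exact mul_le_mul (hx₁ j hj.1) (hx₂ _ hj.2.1) (norm_nonneg _) hB₁
        · rw [if_neg hcond, norm_zero]
          split_ifs <;> positivity
    _ = B₁ * B₂ * ((Icc (1 : ℤ) H).filter fun j : ℤ => (j : ZMod p) = -((a : ZMod p) * z)).card := by
        rw [← sum_filter, sum_const, nsmul_eq_mul, mul_comm]
    _ ≤ B₁ * B₂ * ((H : ℝ) / p + 1) := by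
        gcongr
        have h1 := card_filter_intCast_eq_le H hp (-((a : ZMod p) * z))
        calc (((Icc (1 : ℤ) H).filter fun j : ℤ => (j : ZMod p) = -((a : ZMod p) * z)).card : ℝ)
            ≤ ((H / p + 1 : ℕ) : ℝ) := by exact_mod_cast h1
          _ ≤ (H : ℝ) / p + 1 := by push_cast; gcongr; exact Nat.cast_div_le

/-- `|mean of F_p| ≤ |c_p| B₁ B₂ H / p`. [folklore] -/
theorem norm_FlocMean_le {p : ℕ} (hp : 0 < p) {B₁ B₂ : ℝ} (hB₁ : 0 ≤ B₁) (hB₂ : 0 ≤ B₂)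
    (hx₁ : ∀ j ∈ Icc (1 : ℤ) H, ‖x₁ j‖ ≤ B₁) (hx₂ : ∀ j ∈ Icc (1 : ℤ) H, ‖x₂ j‖ ≤ B₂) :
    ‖FlocMean a H b h c x₁ x₂ p‖ ≤ ‖c p‖ * (B₁ * B₂ * ((H : ℝ) / p)) := by
  unfold FlocMean
  rw [norm_mul, norm_div, Complex.norm_natCast]
  have hp' : (0 : ℝ) < p := by exact_mod_cast hp
  calc ‖c p‖ / p * ‖∑ j ∈ jRange a H b h p, x₁ j * x₂ (j + p * h)‖
      ≤ ‖c p‖ / p * (H * (B₁ * B₂)) := by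
        gcongr
        calc ‖∑ j ∈ jRange a H b h p, x₁ j * x₂ (j + p * h)‖
            ≤ ∑ j ∈ jRange a H b h p, ‖x₁ j * x₂ (j + p * h)‖ := norm_sum_le _ _
          _ ≤ ∑ j ∈ Icc (1 : ℤ) H, B₁ * B₂ := by
              refine (sum_le_sum fun j hj => ?_).trans
                (sum_le_sum_of_subset_of_nonneg (filter_subset _ _) fun _ _ _ => by positivity)
              unfold jRange at hj
              simp only [mem_filter] at hj
              rw [norm_mul]
              exact mul_le_mul (hx₁ j hj.1) (hx₂ _ hj.2.1) (norm_nonneg _) hB₁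
          _ = H * (B₁ * B₂) := by simp
    _ = ‖c p‖ * (B₁ * B₂ * ((H : ℝ) / p)) := by field_simp

/-- The mean of `F_p` over `z ∈ ℤ/pℤ` (for `p` prime, `p ∤ a`): each constraint `p ∣ ay + j`
holds for exactly one residue `y mod p`. [folklore] -/
theorem sum_Floc_eq {p : ℕ} [Fact p.Prime] (hpa : ¬(p ∣ a)) :
    ∑ z : ZMod p, Floc a H b h c x₁ x₂ p z = p * FlocMean a H b h c x₁ x₂ p := by
  have ha : (a : ZMod p) ≠ 0 := by
    rwa [Ne, ZMod.natCast_eq_zero_iff]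
  have hp0 : (p : ℂ) ≠ 0 := by exact_mod_cast (Fact.out : p.Prime).ne_zero
  unfold Floc FlocMean
  rw [← mul_sum, sum_comm]
  rw [show (p : ℂ) * (c p / p * ∑ j ∈ jRange a H b h p, x₁ j * x₂ (j + p * h)) =
      c p * ∑ j ∈ jRange a H b h p, x₁ j * x₂ (j + p * h) by field_simp]
  congr 1
  refine sum_congr rfl fun j _ => ?_
  have hiff : ∀ z : ZMod p, (a : ZMod p) * z + (j : ZMod p) = 0 ↔ z = -(j : ZMod p) / a := by
    intro z
    constructor
    · intro hz; field_simp; linear_combination hz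
    · intro hz; subst hz; field_simp; ring
  simp_rw [hiff]
  rw [Finset.sum_ite_eq' Finset.univ]
  simp

/-! ### Lemma 3.5: concentration of `F(x, ·)` on `ℤ/P_Hℤ` -/

/-- Distinct primes are pairwise coprime (as a family indexed by a finset of primes).
[folklore] -/
theorem pairwise_coprime_subtype (Pr : Finset ℕ) (hPr : ∀ p ∈ Pr, p.Prime) :
    Pairwise (Function.onFun Nat.Coprime fun i : ↥Pr => (i : ℕ)) := by
  intro i j hij
  exact (Nat.coprime_primes (hPr _ i.2) (hPr _ j.2)).2 fun h' => hij (Subtype.ext h')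

/-- **Tao 2016, Lemma 3.5 (Hoeffding inequality), explicit counting form, general `c_p`.**
Let `𝒫` be a nonempty finite set of primes not dividing `a`, `P = ∏_{p∈𝒫} p`, `|c_p| ≤ 1`,
`|x_{1,j}| ≤ B₁`, `|x_{2,j}| ≤ B₂` on `[1, H]` (`B₁, B₂ > 0`), and `t ≥ 0`.  Then the number of
`y ∈ ℤ/Pℤ` with `|F(x, y) - ∑_p (c_p/p) ∑_j 1_{j≡pb (a)} x_{1,j} x_{2,j+ph}| ≥ t` is at most
`4 exp(-t² / (8 ∑_{p∈𝒫} (2 B₁ B₂ (H/p + 1))²)) · P`.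
Printed proof: by the Chinese remainder theorem the `y mod p` (`p ∈ 𝒫`) are jointly independent
and uniform, `F_p(x, y)` is a function of `y mod p` bounded by `O(B₁B₂H/p)`, and Hoeffding's
inequality applies (`hoeffding_count_pi_complex`); the subtracted quantity is the mean
`(1/P) ∑_{y'} F(x, y')` computed prime by prime (`sum_Floc_eq`).  The paper's form
`|E_x| ≤ exp(-ε⁷H/log H) P_H` for `t = ε²H/log H`, `𝒫 = 𝒫_H` follows for `ε` small and `H`
large (`lemma35`). [cite: TaoFMP2016, Lemma 3.5] -/
theorem lemma35_count (Pr : Finset ℕ) (hPr : ∀ p ∈ Pr, p.Prime) (hPra : ∀ p ∈ Pr, ¬(p ∣ a))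
    (hne : Pr.Nonempty) {P : ℕ} [NeZero P] (hP : P = ∏ p ∈ Pr, p) (hc : ∀ p ∈ Pr, ‖c p‖ ≤ 1)
    {B₁ B₂ : ℝ} (hB₁ : 0 < B₁) (hB₂ : 0 < B₂)
    (hx₁ : ∀ j ∈ Icc (1 : ℤ) H, ‖x₁ j‖ ≤ B₁) (hx₂ : ∀ j ∈ Icc (1 : ℤ) H, ‖x₂ j‖ ≤ B₂)
    {t : ℝ} (ht : 0 ≤ t) :
    ((Finset.univ.filter fun y : ZMod P =>
        t ≤ ‖Fbil a H b h c x₁ x₂ Pr y - bilinC H a b h Pr c x₁ x₂‖).card : ℝ) ≤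
      4 * Real.exp (-(t ^ 2 / (8 * ∑ p ∈ Pr, (2 * B₁ * B₂ * ((H : ℝ) / p + 1)) ^ 2))) * P := by
  have hP' : P = ∏ i : ↥Pr, (i : ℕ) := by rw [hP]; exact (Finset.prod_coe_sort Pr id).symm
  subst hP'
  haveI hnz : ∀ i : ↥Pr, NeZero ((i : ↥Pr) : ℕ) := fun i => ⟨(hPr _ i.2).ne_zero⟩
  set Ψ := ZMod.prodEquivPi (fun i : ↥Pr => (i : ℕ)) (pairwise_coprime_subtype Pr hPr) with hΨ
  set g : ∀ i : ↥Pr, ZMod (i : ℕ) → ℂ := fun i z =>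
    Floc a H b h c x₁ x₂ i z - FlocMean a H b h c x₁ x₂ i with hg
  set C : ↥Pr → ℝ := fun i => 2 * B₁ * B₂ * ((H : ℝ) / (i : ℕ) + 1) with hC
  -- hypotheses of Hoeffding
  have hmean : ∀ i : ↥Pr, ∑ z, g i z = 0 := by
    intro i
    haveI : Fact ((i : ℕ).Prime) := ⟨hPr _ i.2⟩
    simp only [hg]
    rw [sum_sub_distrib, sum_Floc_eq (hPra _ i.2), sum_const, card_univ, ZMod.card,
      nsmul_eq_mul, sub_self]
  have hbound : ∀ (i : ↥Pr) (z : ZMod (i : ℕ)), ‖g i z‖ ≤ C i := by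
    intro i z
    have hp : 0 < (i : ℕ) := (hPr _ i.2).pos
    simp only [hg, hC]
    refine (norm_sub_le _ _).trans ?_
    have h1 := norm_Floc_le (a := a) (b := b) (h := h) (c := c) hp hB₁.le hB₂.le hx₁ hx₂ z
    have h2 := norm_FlocMean_le (a := a) (b := b) (h := h) (c := c) (x₁ := x₁) (x₂ := x₂)
      hp hB₁.le hB₂.le hx₁ hx₂
    have h3 := hc (i : ℕ) i.2
    have h4 : 0 ≤ B₁ * B₂ * ((H : ℝ) / (i : ℕ) + 1) := by positivity
    have h5 : 0 ≤ B₁ * B₂ * ((H : ℝ) / (i : ℕ)) := by positivity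
    have h6 : (0 : ℝ) ≤ (H : ℝ) / (i : ℕ) := by positivity
    nlinarith [norm_nonneg (c (i : ℕ))]
  have hS : 0 < ∑ i : ↥Pr, C i ^ 2 := by
    obtain ⟨p, hp⟩ := hne
    refine lt_of_lt_of_le ?_ (single_le_sum (f := fun i => C i ^ 2) (fun i _ => sq_nonneg _)
      (mem_univ ⟨p, hp⟩))
    simp only [hC]
    positivity
  have key := hoeffding_count_pi_complex g C hmean hbound ht hS
  -- identify both sides
  have hsumC : ∑ i : ↥Pr, C i ^ 2 = ∑ p ∈ Pr, (2 * B₁ * B₂ * ((H : ℝ) / p + 1)) ^ 2 := by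
    simp only [hC]
    exact Finset.sum_coe_sort Pr (fun p : ℕ => (2 * B₁ * B₂ * ((H : ℝ) / p + 1)) ^ 2)
  have hprod : ∏ i : ↥Pr, (Fintype.card (ZMod (i : ℕ)) : ℝ) = ((∏ i : ↥Pr, (i : ℕ) : ℕ) : ℝ) := by
    push_cast
    exact prod_congr rfl fun i _ => by rw [ZMod.card]
  have hcard : (Finset.univ.filter fun y : ZMod (∏ i : ↥Pr, (i : ℕ)) =>
      t ≤ ‖Fbil a H b h c x₁ x₂ Pr y - bilinC H a b h Pr c x₁ x₂‖).card =
      (Finset.univ.filter fun z : (∀ i : ↥Pr, ZMod (i : ℕ)) => t ≤ ‖∑ i, g i (z i)‖).card := by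
    refine card_equiv Ψ.toEquiv fun y => ?_
    simp only [mem_filter, mem_univ, true_and]
    suffices hF : Fbil a H b h c x₁ x₂ Pr y - bilinC H a b h Pr c x₁ x₂ =
        ∑ i, g i (Ψ.toEquiv y i) by rw [hF]
    rw [← sum_FlocMean_eq_bilinC]
    simp only [hg, Fbil]
    rw [sum_sub_distrib, ← Finset.sum_coe_sort Pr, ← Finset.sum_coe_sort Pr]
    congr 1
    refine sum_congr rfl fun i _ => ?_
    congr 1
    rw [RingEquiv.toEquiv_eq_coe, EquivLike.coe_coe, hΨ, ZMod.prodEquivPi_apply,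
      ZMod.castHom_apply]
  rw [hcard, hsumC.symm, ← hprod]
  exact key

end TaoF

/-! ### Lemma 3.5 in the paper's form -/

section PaperForm

/-- `𝒫_H` is nonempty once `ε²H ≥ 2` (Bertrand's postulate). [folklore] -/
theorem primesP_nonempty {ε : ℝ} {H : ℕ} (hy : 2 ≤ ε ^ 2 * H) : (primesP ε H).Nonempty := by
  set n : ℕ := ⌊ε ^ 2 * H / 2⌋₊ with hn
  have hy0 : 0 ≤ ε ^ 2 * H / 2 := by positivity
  have hn1 : 1 ≤ n := by
    rw [hn, Nat.one_le_floor_iff]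
    linarith
  obtain ⟨p, hp, hnp, hp2⟩ := Nat.exists_prime_lt_and_le_two_mul n (by omega)
  refine ⟨p, mem_primesP.2 ⟨hp, ?_, ?_⟩⟩
  · have h1 : (ε ^ 2 * H / 2 : ℝ) < n + 1 := by rw [hn]; exact Nat.lt_floor_add_one _
    have h2 : (n : ℝ) + 1 ≤ p := by exact_mod_cast hnp
    linarith
  · have h1 : (n : ℝ) ≤ ε ^ 2 * H / 2 := Nat.floor_le hy0
    have h2 : (p : ℝ) ≤ 2 * n := by exact_mod_cast hp2
    linarith

/-- **Tao 2016, Lemma 3.5, as printed** (with explicit smallness/largeness in place of the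
hierarchy `1/ε ≪ H₋ ≤ H`): let `x = (x_{i,j})` have entries of modulus `≤ 2` (the range of the
discretised `X_H`), `|c_p| ≤ 1` on `𝒫_H`, `0 < ε ≤ 1/27648`, `ε⁴H ≥ 4`, `ε⁷ H / log H ≥ 2`,
`a < ε²H/2` (so that `P_H` is coprime to `a`), `P = P_H = ∏_{p ∈ 𝒫_H} p`.  Let `E_x` be the set of
`y ∈ ℤ/P_Hℤ` with `|F(x, y) - (1/P_H) ∑_{y'} F(x, y')| ≥ ε² H / log H` (the mean being
`∑_{p∈𝒫_H} (c_p/p) ∑_j 1_{j ≡ pb (a)} x_{1,j} x_{2,j+ph} = bilinC`).  Then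
`|E_x| ≤ exp(-ε⁷ H / log H) · P_H`. [cite: TaoFMP2016, Lemma 3.5] -/
theorem lemma35 {a H : ℕ} (ha : 0 < a) (b h : ℤ) {ε : ℝ} (hε : 0 < ε) (hε0 : ε ≤ 1 / 27648)
    (hH : 4 ≤ ε ^ 4 * H) (hH2 : 2 ≤ ε ^ 7 * H / Real.log H) (haε : (a : ℝ) < ε ^ 2 * H / 2)
    (c : ℕ → ℂ) (hc : ∀ p ∈ primesP ε H, ‖c p‖ ≤ 1) (x₁ x₂ : ℤ → ℂ)
    (hx₁ : ∀ j ∈ Icc (1 : ℤ) H, ‖x₁ j‖ ≤ 2) (hx₂ : ∀ j ∈ Icc (1 : ℤ) H, ‖x₂ j‖ ≤ 2)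
    {P : ℕ} [NeZero P] (hP : P = ∏ p ∈ primesP ε H, p) :
    ((Finset.univ.filter fun y : ZMod P =>
        ε ^ 2 * H / Real.log H ≤
          ‖Fbil a H b h c x₁ x₂ (primesP ε H) y - bilinC H a b h (primesP ε H) c x₁ x₂‖).card : ℝ)
      ≤ Real.exp (-(ε ^ 7 * H / Real.log H)) * P := by
  have hε1 : ε ≤ 1 := hε0.trans (by norm_num)
  have hε2 : 0 < ε ^ 2 := by positivity
  have hε4 : ε ^ 4 ≤ 1 := pow_le_one₀ hε.le hε1
  have hH4 : (4 : ℝ) ≤ H := by nlinarith [hH, (Nat.cast_nonneg H : (0 : ℝ) ≤ H)]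
  have hlogH : 0 < Real.log H := Real.log_pos (by linarith)
  have hy : 2 ≤ ε ^ 2 * H := by nlinarith
  set Pr := primesP ε H with hPr
  have hprime : ∀ p ∈ Pr, p.Prime := fun p hp => prime_of_mem_primesP hp
  have hPra : ∀ p ∈ Pr, ¬(p ∣ a) := by
    intro p hp hpa
    have h1 := (mem_primesP.1 hp).2.1
    have h2 : (p : ℝ) ≤ a := by exact_mod_cast Nat.le_of_dvd ha hpa
    linarith
  have hne : Pr.Nonempty := primesP_nonempty hy
  have ht : 0 ≤ ε ^ 2 * H / Real.log H := by positivity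
  have hcount := lemma35_count (a := a) (H := H) (b := b) (h := h) (c := c) (x₁ := x₁) (x₂ := x₂)
    Pr hprime hPra hne hP hc (by norm_num : (0 : ℝ) < 2) (by norm_num : (0 : ℝ) < 2) hx₁ hx₂ ht
  refine hcount.trans ?_
  obtain ⟨hcard, _⟩ := card_primesP_le hε hε1 hH
  -- `∑_p C_p² ≤ 1728 H / (ε² log H)`
  have hCp : ∀ p ∈ Pr, (2 * 2 * 2 * ((H : ℝ) / p + 1)) ^ 2 ≤ 576 / ε ^ 4 := by
    intro p hp
    have h1 := (mem_primesP.1 hp).2.1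
    have hp0 : (0 : ℝ) < p := by linarith
    have h2 : (H : ℝ) / p ≤ 2 / ε ^ 2 := by
      rw [div_le_div_iff₀ hp0 hε2]; nlinarith
    have h3 : (H : ℝ) / p + 1 ≤ 3 / ε ^ 2 := by
      have : (1 : ℝ) ≤ 1 / ε ^ 2 := by
        rw [le_div_iff₀ hε2]; nlinarith
      have h33 : (3 : ℝ) / ε ^ 2 = 2 / ε ^ 2 + 1 / ε ^ 2 := by ring
      linarith
    have h4 : 0 ≤ (H : ℝ) / p + 1 := by positivity
    calc (2 * 2 * 2 * ((H : ℝ) / p + 1)) ^ 2 = 64 * ((H : ℝ) / p + 1) ^ 2 := by ring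
      _ ≤ 64 * (3 / ε ^ 2) ^ 2 := by gcongr
      _ = 576 / ε ^ 4 := by field_simp; ring
  have hS : ∑ p ∈ Pr, (2 * 2 * 2 * ((H : ℝ) / p + 1)) ^ 2 ≤ 1728 * H / (ε ^ 2 * Real.log H) := by
    calc ∑ p ∈ Pr, (2 * 2 * 2 * ((H : ℝ) / p + 1)) ^ 2 ≤ ∑ p ∈ Pr, 576 / ε ^ 4 := sum_le_sum hCp
      _ = Pr.card * (576 / ε ^ 4) := by rw [sum_const, nsmul_eq_mul]
      _ ≤ 3 * (ε ^ 2 * H) / Real.log H * (576 / ε ^ 4) := by gcongr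
      _ = 1728 * H / (ε ^ 2 * Real.log H) := by field_simp; ring
  have hS0 : 0 < ∑ p ∈ Pr, (2 * 2 * 2 * ((H : ℝ) / p + 1)) ^ 2 := by
    obtain ⟨p, hp⟩ := hne
    exact lt_of_lt_of_le (by positivity) (single_le_sum (f := fun p : ℕ =>
      (2 * 2 * 2 * ((H : ℝ) / p + 1)) ^ 2) (fun _ _ => sq_nonneg _) hp)
  -- the exponent
  have hexp : ε ^ 6 * H / (13824 * Real.log H) ≤
      (ε ^ 2 * H / Real.log H) ^ 2 / (8 * ∑ p ∈ Pr, (2 * 2 * 2 * ((H : ℝ) / p + 1)) ^ 2) := by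
    rw [div_le_div_iff₀ (by positivity) (by positivity)]
    calc ε ^ 6 * H * (8 * ∑ p ∈ Pr, (2 * 2 * 2 * ((H : ℝ) / p + 1)) ^ 2)
        ≤ ε ^ 6 * H * (8 * (1728 * H / (ε ^ 2 * Real.log H))) := by gcongr
      _ = (ε ^ 2 * H / Real.log H) ^ 2 * (13824 * Real.log H) := by field_simp; ring
  have hfin : Real.log 4 + ε ^ 7 * H / Real.log H ≤ ε ^ 6 * H / (13824 * Real.log H) := by
    have hlog4 : Real.log 4 < 2 := by
      have := Real.log_two_lt_d9
      rw [show (4 : ℝ) = 2 ^ 2 by norm_num, Real.log_pow]; push_cast; linarith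
    have h1 : 2 * (ε ^ 7 * H / Real.log H) ≤ ε ^ 6 * H / (13824 * Real.log H) := by
      rw [show 2 * (ε ^ 7 * H / Real.log H) = (2 * ε ^ 7 * 13824) * H / (13824 * Real.log H) by
        field_simp]
      have : 2 * ε ^ 7 * 13824 ≤ ε ^ 6 := by
        calc 2 * ε ^ 7 * 13824 = ε ^ 6 * (27648 * ε) := by ring
          _ ≤ ε ^ 6 * 1 := by gcongr; linarith
          _ = ε ^ 6 := by ring
      gcongr
    linarith
  calc 4 * Real.exp (-((ε ^ 2 * H / Real.log H) ^ 2 /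
          (8 * ∑ p ∈ Pr, (2 * 2 * 2 * ((H : ℝ) / p + 1)) ^ 2))) * P
      ≤ 4 * Real.exp (-(ε ^ 6 * H / (13824 * Real.log H))) * P := by
        gcongr
    _ = Real.exp (Real.log 4 - ε ^ 6 * H / (13824 * Real.log H)) * P := by
        rw [Real.exp_sub, Real.exp_log (by norm_num), Real.exp_neg]; ring
    _ ≤ Real.exp (-(ε ^ 7 * H / Real.log H)) * P := by
        gcongr
        linarith

end PaperForm

end Tao2016
end Literature.NumberTheory.LFunctions
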